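import Mathlib.Combinatorics.SimpleGraph.Maps
import Mathlib.Combinatorics.SimpleGraph.Sum
import Mathlib.Data.Set.Card
import Mathlib.Logic.Equiv.Fin.Basic
import Mathlib.SetTheory.Cardinal.Finite
import Literature.Combinatorics.SimpleGraph.TreeDecomposition
import HarnessLib

/-!
# Counting-logic equivalence `G ≡_{C^k} H` of graphs: the bijective `k`-pebble game

Topic `Literature/ModelTheory/FiniteModelTheory`; definition request `defn-CkEquiv` (route
PneNP/PhaseTwins, whose cruxes are TYPED in the homomorphism-count form, see the bridge fact
below; shared with route PneNP/Descriptive, crux "CFI query vs CPT", which plays the same game on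
`cfiGraph`).

Two (simple, loopless) graphs `G`, `H` are `C^k`-EQUIVALENT, `G ≡_{C^k} H`, when no sentence of
the `k`-variable fragment `C^k` of first-order logic with counting quantifiers `∃^{≥ i} x`
tells them apart. On finite structures this is the same as `C^k_{∞ω}`-equivalence, as
indistinguishability by the `(k-1)`-dimensional Weisfeiler–Leman refinement (Cai–Fürer–Immerman
1992, Thm 5.2; Immerman–Lander 1990), and — the form taken as THE DEFINITION here — as the
existence of a winning strategy for Duplicator in Hella's BIJECTIVE `k`-PEBBLE GAME
(Hella 1996; Grohe–Otto 2015, Thm 2.2): positions are sets `p ⊆ V(G) × V(H)` of at most `k`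
pebble pairs; in a round Spoiler may first lift pebble pairs (so that fewer than `k` remain),
Duplicator must then name a BIJECTION `f : V(G) → V(H)` (she loses at once if there is none),
Spoiler picks `a ∈ V(G)` and the pair `(a, f a)` is pebbled; Duplicator must keep every position
a partial isomorphism for ever. A winning strategy is exactly a BACK-AND-FORTH SYSTEM
(`BijPebbleStrategy`): a family `S` of partial isomorphisms of size `≤ k`, containing `∅`, closed
under subsets, such that every `p ∈ S` with `|p| < k` admits a bijection `f` with
`p ∪ {(a, f a)} ∈ S` for all `a` (the shape of the request; cf. the Sherali–Adams-type system
`L^k_iso` of Dell–Grohe–Rattan 2018, §1, whose variables `X_π` are indexed by the same positions).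

* `IsPartialIso G H p` — `p ⊆ V(G) × V(H)` is a partial isomorphism ("local isomorphism"):
  `a = a' ↔ b = b'` and `a ~ a' ↔ b ~ b'` for all `(a, b), (a', b') ∈ p`
  (Dell–Grohe–Rattan 2018, §1/§8; Grohe–Otto 2015, §2);
* `BijPebbleStrategy k G H` (data: the family `S`) and `CkEquiv k G H := Nonempty
  (BijPebbleStrategy k G H)`;
* API, all proved: `CkEquiv.zero`, `CkEquiv.mono`, `CkEquiv.of_iso`, `CkEquiv.refl`, `CkEquiv.symm`,
  `CkEquiv.nonempty_equiv` (for `k ≥ 1` the vertex sets are in bijection), `ckEquiv_one_iff`,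
  and the first closure fact the route asked for, `CkEquiv.sum`: `G₁ ≡ H₁ → G₂ ≡ H₂ →
  G₁ ⊕g G₂ ≡ H₁ ⊕g H₂` (Duplicator plays the two strategies side by side);
* the NAMED FACT `Dvorak2010_ckEquiv_iff_homCount` (Dvořák 2010, Thm 6 = Dell–Grohe–Rattan 2018,
  Thm 3 with Lemma 12, composed with Hella's theorem): for `k ≥ 2` and finite graphs `G`, `H` on
  `Fin n`, `Fin m`, `G ≡_{C^k} H` iff `hom(F, G) = hom(F, H)` for every finite graph `F` of
  treewidth `< k` (i.e. `≤ k - 1`), with the tree's `Literature.Combinatorics.SimpleGraph.treewidth`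
  and Mathlib's `F →g G`; this is literally the hypothesis shape of the PhaseTwins cruxes.

INDEXING. `k` = number of pebble PAIRS = number of variables: `CkEquiv k` is `≡_{C^k}`, which is
`(k-1)`-WL-equivalence and hom-indistinguishability over treewidth `≤ k-1`. `CkEquiv 0` always
holds (`CkEquiv.zero`), `CkEquiv 1 G H ↔ (V(G) ≃ V(H))` (`ckEquiv_one_iff`; `C^1` only counts
vertices).

Design. Positions are `Set (α × β)` with `Set.Finite`/`Set.ncard` (no decidability instances in
the definition; for finite vertex types finiteness is `Set.toFinite _`). The vertex types are
arbitrary; the cited characterisations (Hella, Dvořák, CFI) concern FINITE graphs, and the named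
fact is stated for graphs on `Fin n` only. NOT here: the syntax/semantics of `C^k` and of
Weisfeiler–Leman refinement (the game form was requested as acceptable alone); transitivity of
`CkEquiv` and transport along isomorphisms on both sides (follow from the bridge for finite graphs;
direct game proofs deferred to a follow-up file); the second requested closure fact —
preservation under parameter-free FO-interpretations of dimension `d` (`≡_{C^{dk+t}} ⇒ ≡_{C^k}` of
the interpreted structures, Atserias–Dawar 2019, Lemma 1) — which needs a Lean notion of
FO-interpretation between relational structures first (a separate definition request); the
Cai–Fürer–Immerman lower bound itself.

## References

* [Hella1996] L. Hella, *Logical hierarchies in PTIME*, Inform. and Comput. 129 (1996) 1–19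
  (the original of the bijective `k`-pebble game and of its characterisation of
  `C^k_{∞ω}`-equivalence; paywalled, not re-read — acquisition request acq-02317; cited through
  Grohe–Otto 2015, Thm 2.2 and Atserias–Dawar 2019, §2.1, which restate it).
* [GroheOtto2015] M. Grohe, M. Otto, *Pebble games and linear equations*, J. Symb. Log. 80
  (2015) 797–844, §2 (positions `p ⊆ A × B`, local isomorphisms, Thm 2.2 = Hella's theorem).
  Read via `lit read arxiv:1204.1990`, pp. 5, 18.
* [DellGroheRattan2018] H. Dell, M. Grohe, G. Rattan, *Lovász meets Weisfeiler and Leman*,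
  ICALP 2018, LIPIcs 107, 40:1–40:14, arXiv:1802.08876: §1 (partial isomorphisms `π ⊆ V × W`,
  system `L^k_iso`), Thm 3 (`k ≥ 1`: `hom_{T_k}(G) = hom_{T_k}(H)` iff `k`-WL does not
  distinguish `G`, `H`), Lemma 12 [Immerman–Lander 1990] (`k`-WL ≡ `C^{k+1}`). Read pp. 4, 14.
* [Dvorak2010] Z. Dvořák, *On recognizing graphs by numbers of homomorphisms*, J. Graph Theory
  64 (2010) 330–342, Thm 6 of the author's version (`∃ φ ∈ C^{k+1}` separating `H₁`, `H₂` iff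
  `∃ G` of tree-width `≤ k` with `Hom(G, H₁) ≠ Hom(G, H₂)`). Read pp. 5–7.
* [CaiFurerImmerman1992] J.-Y. Cai, M. Fürer, N. Immerman, Combinatorica 12 (1992), §4–5
  (`C^k` vs. `(k-1)`-WL, Thm 5.2); [ImmermanLander1990]; [AtseriasDawar2019] §2.1–2.2
  (the game as used by the requesting route; Lemma 1 on interpretations). Read pp. 6–8.
-/

namespace Literature.ModelTheory.FiniteModelTheory

variable {α β γ : Type*}

/-! ### Partial isomorphisms (positions of the pebble game) -/

/-- A set `p ⊆ V(G) × V(H)` of pebble pairs is a **partial isomorphism** from `G` to `H`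
("local isomorphism"): for all `(a, b), (a', b') ∈ p`, `a = a' ↔ b = b'` (so `p` is a partial
bijection) and `a ~_G a' ↔ b ~_H b'`. Equivalently `p` is the graph of an isomorphism between
the induced subgraphs on its two projections. [Dell–Grohe–Rattan 2018, §1 and §8;
Grohe–Otto 2015, §2] [cite: DellGroheRattan2018, §1 (partial isomorphism π ⊆ V × W)] -/
structure IsPartialIso (G : SimpleGraph α) (H : SimpleGraph β) (p : Set (α × β)) : Prop where
  /-- `p` is a partial bijection: `a = a' ↔ b = b'`. -/
  eq_iff : ∀ ⦃x : α × β⦄, x ∈ p → ∀ ⦃y : α × β⦄, y ∈ p → (x.1 = y.1 ↔ x.2 = y.2)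
  /-- `p` preserves adjacency and non-adjacency. -/
  adj_iff : ∀ ⦃x : α × β⦄, x ∈ p → ∀ ⦃y : α × β⦄, y ∈ p → (G.Adj x.1 y.1 ↔ H.Adj x.2 y.2)

namespace IsPartialIso

variable {G : SimpleGraph α} {H : SimpleGraph β} {p q : Set (α × β)}

/-- The empty position is a partial isomorphism. [folklore] -/
theorem empty (G : SimpleGraph α) (H : SimpleGraph β) : IsPartialIso G H ∅ :=
  ⟨fun x hx => (Set.notMem_empty x hx).elim, fun x hx => (Set.notMem_empty x hx).elim⟩

/-- Sub-positions of partial isomorphisms are partial isomorphisms (lifting pebbles is safe).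
[folklore] -/
theorem mono (h : IsPartialIso G H p) (hqp : q ⊆ p) : IsPartialIso G H q :=
  ⟨fun _ hx _ hy => h.eq_iff (hqp hx) (hqp hy), fun _ hx _ hy => h.adj_iff (hqp hx) (hqp hy)⟩

/-- A single pebble pair is always a partial isomorphism (graphs are loopless). [folklore] -/
theorem singleton (G : SimpleGraph α) (H : SimpleGraph β) (a : α) (b : β) :
    IsPartialIso G H {(a, b)} := by
  refine ⟨fun x hx y hy => ?_, fun x hx y hy => ?_⟩ <;>
    rw [Set.mem_singleton_iff] at hx hy <;> subst hx <;> subst hy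
  · simp
  · simp

/-- A position all of whose pairs coincide is a partial isomorphism (at most one pebble pair,
possibly repeated). [folklore] -/
theorem of_subsingleton (G : SimpleGraph α) (H : SimpleGraph β)
    (hp : ∀ x ∈ p, ∀ y ∈ p, x = y) : IsPartialIso G H p := by
  refine ⟨fun x hx y hy => ?_, fun x hx y hy => ?_⟩ <;> obtain rfl := hp x hx y hy
  · simp
  · simp

/-- Reversing all pairs turns a partial isomorphism from `G` to `H` into one from `H` to `G`.
[folklore] -/
theorem swap (h : IsPartialIso G H p) : IsPartialIso H G (Prod.swap ⁻¹' p) :=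
  ⟨fun _ hx _ hy => (h.eq_iff hx hy).symm, fun _ hx _ hy => (h.adj_iff hx hy).symm⟩

/-- Any set of pairs taken from the graph of an isomorphism `e : G ≃g H` is a partial
isomorphism. [folklore] -/
theorem of_iso (e : G ≃g H) (hp : ∀ x ∈ p, x.2 = e x.1) : IsPartialIso G H p := by
  refine ⟨fun x hx y hy => ?_, fun x hx y hy => ?_⟩
  · rw [hp x hx, hp y hy]
    exact e.injective.eq_iff.symm
  · rw [hp x hx, hp y hy]
    exact e.map_adj_iff.symm

end IsPartialIso

/-! ### Duplicator's winning strategies and `C^k`-equivalence -/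

/-- A **winning strategy for Duplicator in the bijective `k`-pebble game** on `G`, `H`
(Hella 1996), presented as a back-and-forth system: a family `carrier` ("`S`") of positions
`p ⊆ V(G) × V(H)` such that `∅ ∈ S`; every `p ∈ S` is finite, has at most `k` pairs and is a
partial isomorphism; `S` is closed under sub-positions (Spoiler may lift pebble pairs); and the
BIJECTIVE FORTH PROPERTY holds: whenever `p ∈ S` has fewer than `k` pairs there is a bijection
`f : V(G) ≃ V(H)` such that `p ∪ {(a, f a)} ∈ S` for every `a ∈ V(G)` (Duplicator announces
`f`, Spoiler pebbles any `a` and its image). If `V(G)` and `V(H)` are not in bijection no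
strategy exists once `k ≥ 1` (`CkEquiv.nonempty_equiv`). The game is Hella's (Hella 1996, the
original, not re-read: paywalled, acq-02317); the description followed here is the one printed
in Grohe–Otto 2015, §2 ("positions" `p ⊆ A × B` of at most `k` pairs, "local isomorphisms",
Duplicator "chooses a bijection", "immediately looses" if there is none) and Atserias–Dawar
2019, §2.1; cf. Dell–Grohe–Rattan 2018, §1 (system `L^k_iso`: the support of a nonnegative
solution is such a family). [cite: GroheOtto2015, §2 (bijective k-pebble game; Thm 2.2)] -/
structure BijPebbleStrategy (k : ℕ) (G : SimpleGraph α) (H : SimpleGraph β) where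
  /-- The family `S` of winning positions. -/
  carrier : Set (Set (α × β))
  /-- The initial (empty) position is winning. -/
  empty_mem : ∅ ∈ carrier
  /-- Positions are finite sets of pebble pairs … -/
  finite_of_mem : ∀ ⦃p : Set (α × β)⦄, p ∈ carrier → p.Finite
  /-- … with at most `k` pairs … -/
  ncard_le_of_mem : ∀ ⦃p : Set (α × β)⦄, p ∈ carrier → p.ncard ≤ k
  /-- … and each is a partial isomorphism. -/
  isPartialIso_of_mem : ∀ ⦃p : Set (α × β)⦄, p ∈ carrier → IsPartialIso G H p
  /-- Closure under lifting pebble pairs. -/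
  mem_of_subset : ∀ ⦃p : Set (α × β)⦄, p ∈ carrier → ∀ ⦃q : Set (α × β)⦄, q ⊆ p → q ∈ carrier
  /-- The bijective forth property. -/
  forth : ∀ ⦃p : Set (α × β)⦄, p ∈ carrier → p.ncard < k →
    ∃ f : α ≃ β, ∀ a : α, insert (a, f a) p ∈ carrier

/-- **`C^k`-equivalence** `G ≡_{C^k} H` of two graphs: Duplicator has a winning strategy in the
bijective `k`-pebble game on `G` and `H`. For finite graphs this is equivalence in `k`-variable
first-order logic with counting (Hella 1996), indistinguishability by `(k-1)`-dimensional
Weisfeiler–Leman refinement (Cai–Fürer–Immerman 1992, Thm 5.2; `k ≥ 2`) and homomorphism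
indistinguishability over graphs of treewidth `≤ k - 1` (Dvořák 2010; Dell–Grohe–Rattan 2018;
the named fact `Dvorak2010_ckEquiv_iff_homCount` below). Hella's theorem as printed in
Grohe–Otto 2015, Thm 2.2: "`A ≡_{C^k} B` if, and only if, player II has a winning strategy for
the bijective `k`-pebble game on `A`, `B`." [Hella 1996; Grohe–Otto 2015, Thm 2.2;
Cai–Fürer–Immerman 1992, §4–5; Atserias–Dawar 2019, §2.1]
[cite: GroheOtto2015, Thm 2.2 (Hella's theorem: C^k-equivalence iff Duplicator wins the bijective
k-pebble game)] -/
def CkEquiv (k : ℕ) (G : SimpleGraph α) (H : SimpleGraph β) : Prop :=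
  Nonempty (BijPebbleStrategy k G H)

namespace CkEquiv

variable {G : SimpleGraph α} {H : SimpleGraph β} {k j : ℕ}

/-- With no pebbles Duplicator wins trivially: `S = {∅}`. [folklore] -/
theorem zero (G : SimpleGraph α) (H : SimpleGraph β) : CkEquiv 0 G H :=
  ⟨{ carrier := {∅}
     empty_mem := rfl
     finite_of_mem := fun p hp => by
       rw [Set.mem_singleton_iff.1 hp]; exact Set.finite_empty
     ncard_le_of_mem := fun p hp => by rw [Set.mem_singleton_iff.1 hp, Set.ncard_empty]
     isPartialIso_of_mem := fun p hp => by
       rw [Set.mem_singleton_iff.1 hp]; exact IsPartialIso.empty G H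
     mem_of_subset := fun p hp q hq => by
       rw [Set.mem_singleton_iff.1 hp] at hq
       exact Set.mem_singleton_iff.2 (Set.subset_empty_iff.1 hq)
     forth := fun p _ hp => (Nat.not_lt_zero _ hp).elim }⟩

/-- Fewer pebbles are easier for Duplicator: `≡_{C^k}` implies `≡_{C^j}` for `j ≤ k` (keep the
positions with at most `j` pairs). [folklore] -/
theorem mono (h : CkEquiv k G H) (hjk : j ≤ k) : CkEquiv j G H := by
  obtain ⟨S⟩ := h
  exact ⟨
    { carrier := {p | p ∈ S.carrier ∧ p.ncard ≤ j}
      empty_mem := ⟨S.empty_mem, by simp⟩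
      finite_of_mem := fun p hp => S.finite_of_mem hp.1
      ncard_le_of_mem := fun p hp => hp.2
      isPartialIso_of_mem := fun p hp => S.isPartialIso_of_mem hp.1
      mem_of_subset := fun p hp q hq =>
        ⟨S.mem_of_subset hp.1 hq, (Set.ncard_le_ncard hq (S.finite_of_mem hp.1)).trans hp.2⟩
      forth := fun p hp hpj => by
        obtain ⟨f, hf⟩ := S.forth hp.1 (lt_of_lt_of_le hpj hjk)
        exact ⟨f, fun a => ⟨hf a, (Set.ncard_insert_le _ _).trans (Nat.succ_le_of_lt hpj)⟩⟩ }⟩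

/-- Isomorphic graphs are `C^k`-equivalent for every `k`: Duplicator always announces the
isomorphism. [folklore] -/
theorem of_iso (e : G ≃g H) (k : ℕ) : CkEquiv k G H :=
  ⟨{ carrier := {p | p.Finite ∧ p.ncard ≤ k ∧ ∀ x ∈ p, x.2 = e x.1}
     empty_mem := ⟨Set.finite_empty, by simp, fun x hx => (Set.notMem_empty x hx).elim⟩
     finite_of_mem := fun p hp => hp.1
     ncard_le_of_mem := fun p hp => hp.2.1
     isPartialIso_of_mem := fun p hp => IsPartialIso.of_iso e hp.2.2
     mem_of_subset := fun p hp q hq =>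
       ⟨hp.1.subset hq, (Set.ncard_le_ncard hq hp.1).trans hp.2.1, fun x hx => hp.2.2 x (hq hx)⟩
     forth := fun p hp hpk => ⟨e.toEquiv, fun a =>
       ⟨hp.1.insert _, (Set.ncard_insert_le _ _).trans (Nat.succ_le_of_lt hpk), by
         rintro x (rfl | hx)
         · rfl
         · exact hp.2.2 x hx⟩⟩ }⟩

/-- `≡_{C^k}` is reflexive. [folklore] -/
theorem refl (G : SimpleGraph α) (k : ℕ) : CkEquiv k G G :=
  of_iso SimpleGraph.Iso.refl k

/-- Reversing the pairs of a position twice gives it back. [folklore] -/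
theorem swap_preimage_swap_preimage (q : Set (β × α)) :
    Prod.swap ⁻¹' (Prod.swap ⁻¹' q) = q := by
  ext x; simp

/-- `≡_{C^k}` is symmetric: reverse every position and invert the announced bijections.
[folklore] -/
theorem symm (h : CkEquiv k G H) : CkEquiv k H G := by
  obtain ⟨S⟩ := h
  have hnc : ∀ q : Set (β × α), (Prod.swap ⁻¹' q).ncard = q.ncard := fun q => by
    rw [← congrFun Set.image_swap_eq_preimage_swap q,
      Set.ncard_image_of_injective q Prod.swap_injective]
  exact ⟨
    { carrier := {q | Prod.swap ⁻¹' q ∈ S.carrier}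
      empty_mem := by
        show Prod.swap ⁻¹' (∅ : Set (β × α)) ∈ S.carrier
        rw [Set.preimage_empty]; exact S.empty_mem
      finite_of_mem := fun q hq => (S.finite_of_mem hq).of_preimage Prod.swap_surjective
      ncard_le_of_mem := fun q hq => (hnc q) ▸ S.ncard_le_of_mem hq
      isPartialIso_of_mem := fun q hq => by
        simpa only [swap_preimage_swap_preimage] using (S.isPartialIso_of_mem hq).swap
      mem_of_subset := fun q hq q' hq' => S.mem_of_subset hq (Set.preimage_mono hq')
      forth := fun q hq hqk => by
        obtain ⟨f, hf⟩ := S.forth hq ((hnc q).symm ▸ hqk)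
        refine ⟨f.symm, fun b => ?_⟩
        have heq : Prod.swap ⁻¹' (insert (b, f.symm b) q) =
            insert (f.symm b, b) (Prod.swap ⁻¹' q) := by
          ext ⟨x₁, x₂⟩
          simp only [Set.mem_preimage, Prod.swap_prod_mk, Set.mem_insert_iff, Prod.mk.injEq]
          tauto
        show Prod.swap ⁻¹' (insert (b, f.symm b) q) ∈ S.carrier
        rw [heq]
        simpa only [Equiv.apply_symm_apply] using hf (f.symm b) }⟩

/-- With at least one pebble pair, `C^k`-equivalent graphs have vertex sets in bijection
(Duplicator's first announced bijection); in particular finite ones have the same order.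
[Atserias–Dawar 2019, §2.1 ("A ≢_{C^1} B whenever A and B have different numbers of elements")]
[cite: AtseriasDawar2019, §2.1] -/
theorem nonempty_equiv (h : CkEquiv k G H) (hk : 0 < k) : Nonempty (α ≃ β) := by
  obtain ⟨S⟩ := h
  obtain ⟨f, -⟩ := S.forth S.empty_mem (by rwa [Set.ncard_empty])
  exact ⟨f⟩

/-- Finite `C^k`-equivalent graphs (`k ≥ 1`) have the same number of vertices.
[cite: AtseriasDawar2019, §2.1] -/
theorem card_eq [Fintype α] [Fintype β] (h : CkEquiv k G H) (hk : 0 < k) :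
    Fintype.card α = Fintype.card β := by
  obtain ⟨f⟩ := h.nonempty_equiv hk
  exact Fintype.card_congr f

end CkEquiv

/-- `C^1`-equivalence is just equinumerosity of the vertex sets: with a single pebble pair every
position is a partial isomorphism (graphs are loopless), so Duplicator only needs SOME bijection.
[Atserias–Dawar 2019, §2.1] [folklore] -/
theorem ckEquiv_one_iff {G : SimpleGraph α} {H : SimpleGraph β} :
    CkEquiv 1 G H ↔ Nonempty (α ≃ β) := by
  refine ⟨fun h => h.nonempty_equiv one_pos, fun ⟨f⟩ => ⟨?_⟩⟩
  exact { carrier := {p | p.Finite ∧ p.ncard ≤ 1}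
          empty_mem := ⟨Set.finite_empty, by simp⟩
          finite_of_mem := fun p hp => hp.1
          ncard_le_of_mem := fun p hp => hp.2
          isPartialIso_of_mem := fun p hp =>
            IsPartialIso.of_subsingleton G H ((Set.ncard_le_one hp.1).1 hp.2)
          mem_of_subset := fun p hp q hq =>
            ⟨hp.1.subset hq, (Set.ncard_le_ncard hq hp.1).trans hp.2⟩
          forth := fun p hp hp1 => ⟨f, fun a =>
            ⟨hp.1.insert _, (Set.ncard_insert_le _ _).trans (Nat.succ_le_of_lt hp1)⟩⟩ }

/-- For graphs on `Fin n`, `Fin m`: `C^1`-equivalence is `n = m`. [folklore] -/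
theorem ckEquiv_one_iff_eq {n m : ℕ} {G : SimpleGraph (Fin n)} {H : SimpleGraph (Fin m)} :
    CkEquiv 1 G H ↔ n = m :=
  ckEquiv_one_iff.trans ⟨fun ⟨f⟩ => Fin.equiv_iff_eq.1 ⟨f⟩, fun h => Fin.equiv_iff_eq.2 h⟩

/-! ### Closure under disjoint unions -/

namespace CkEquiv

variable {α₁ α₂ β₁ β₂ : Type*} {G₁ : SimpleGraph α₁} {G₂ : SimpleGraph α₂}
  {H₁ : SimpleGraph β₁} {H₂ : SimpleGraph β₂} {k : ℕ}

/-- **`≡_{C^k}` is preserved by disjoint unions**: if `G₁ ≡_{C^k} H₁` and `G₂ ≡_{C^k} H₂` then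
`G₁ ⊕g G₂ ≡_{C^k} H₁ ⊕g H₂`. Duplicator plays the two strategies side by side: a position on
the sums is winning when all its pairs are same-sided and its left and right parts are winning;
she announces the sum `f₁ ⊕ f₂` of the two announced bijections (each part has fewer than `k`
pairs when the whole position has). (The first of the two closure facts requested by route
PneNP/PhaseTwins — "disjoint unions preserve C^k-equivalence" — used there to stack copies of
CFI pairs.) [folklore] -/
theorem sum (h₁ : CkEquiv k G₁ H₁) (h₂ : CkEquiv k G₂ H₂) :
    CkEquiv k (G₁ ⊕g G₂) (H₁ ⊕g H₂) := by
  obtain ⟨S₁⟩ := h₁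
  obtain ⟨S₂⟩ := h₂
  -- left and right parts of a position on the sums
  let L : Set ((α₁ ⊕ α₂) × (β₁ ⊕ β₂)) → Set (α₁ × β₁) := fun r => Prod.map Sum.inl Sum.inl ⁻¹' r
  let R : Set ((α₁ ⊕ α₂) × (β₁ ⊕ β₂)) → Set (α₂ × β₂) := fun r => Prod.map Sum.inr Sum.inr ⁻¹' r
  have hLinj : Function.Injective (Prod.map Sum.inl Sum.inl : α₁ × β₁ → (α₁ ⊕ α₂) × (β₁ ⊕ β₂)) :=
    Sum.inl_injective.prodMap Sum.inl_injective
  have hRinj : Function.Injective (Prod.map Sum.inr Sum.inr : α₂ × β₂ → (α₁ ⊕ α₂) × (β₁ ⊕ β₂)) :=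
    Sum.inr_injective.prodMap Sum.inr_injective
  have hLle : ∀ r : Set ((α₁ ⊕ α₂) × (β₁ ⊕ β₂)), r.Finite → (L r).ncard ≤ r.ncard := fun r hr =>
    Set.ncard_le_ncard_of_injOn (Prod.map Sum.inl Sum.inl) (fun x hx => hx) (hLinj.injOn) hr
  have hRle : ∀ r : Set ((α₁ ⊕ α₂) × (β₁ ⊕ β₂)), r.Finite → (R r).ncard ≤ r.ncard := fun r hr =>
    Set.ncard_le_ncard_of_injOn (Prod.map Sum.inr Sum.inr) (fun x hx => hx) (hRinj.injOn) hr
  refine ⟨{ carrier := {r | r.Finite ∧ r.ncard ≤ k ∧ (∀ x ∈ r, x.1.isLeft = x.2.isLeft) ∧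
              L r ∈ S₁.carrier ∧ R r ∈ S₂.carrier}
            empty_mem := ?_
            finite_of_mem := fun r hr => hr.1
            ncard_le_of_mem := fun r hr => hr.2.1
            isPartialIso_of_mem := ?_
            mem_of_subset := ?_
            forth := ?_ }⟩
  · refine ⟨Set.finite_empty, by simp, fun x hx => (Set.notMem_empty x hx).elim, ?_, ?_⟩
    · show Prod.map Sum.inl Sum.inl ⁻¹' (∅ : Set ((α₁ ⊕ α₂) × (β₁ ⊕ β₂))) ∈ S₁.carrier
      rw [Set.preimage_empty]; exact S₁.empty_mem
    · show Prod.map Sum.inr Sum.inr ⁻¹' (∅ : Set ((α₁ ⊕ α₂) × (β₁ ⊕ β₂))) ∈ S₂.carrier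
      rw [Set.preimage_empty]; exact S₂.empty_mem
  · rintro r ⟨-, -, hss, hL, hR⟩
    have hP₁ := S₁.isPartialIso_of_mem hL
    have hP₂ := S₂.isPartialIso_of_mem hR
    -- every pebble pair of `r` is same-sided
    have hform : ∀ x ∈ r,
        (∃ a b, x = (Sum.inl a, Sum.inl b)) ∨ (∃ a b, x = (Sum.inr a, Sum.inr b)) := by
      rintro ⟨a | a, b | b⟩ hx
      · exact Or.inl ⟨a, b, rfl⟩
      · simpa using hss _ hx
      · simpa using hss _ hx
      · exact Or.inr ⟨a, b, rfl⟩
    refine ⟨fun x hx y hy => ?_, fun x hx y hy => ?_⟩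
    · rcases hform x hx with ⟨a, b, rfl⟩ | ⟨a, b, rfl⟩ <;>
        rcases hform y hy with ⟨a', b', rfl⟩ | ⟨a', b', rfl⟩
      · simpa using hP₁.eq_iff (x := (a, b)) (y := (a', b')) hx hy
      · simp
      · simp
      · simpa using hP₂.eq_iff (x := (a, b)) (y := (a', b')) hx hy
    · rcases hform x hx with ⟨a, b, rfl⟩ | ⟨a, b, rfl⟩ <;>
        rcases hform y hy with ⟨a', b', rfl⟩ | ⟨a', b', rfl⟩
      · simpa using hP₁.adj_iff (x := (a, b)) (y := (a', b')) hx hy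
      · simp
      · simp
      · simpa using hP₂.adj_iff (x := (a, b)) (y := (a', b')) hx hy
  · rintro r ⟨hfin, hcard, hss, hL, hR⟩ r' hr'
    exact ⟨hfin.subset hr', (Set.ncard_le_ncard hr' hfin).trans hcard, fun x hx => hss x (hr' hx),
      S₁.mem_of_subset hL (Set.preimage_mono hr'), S₂.mem_of_subset hR (Set.preimage_mono hr')⟩
  · rintro r ⟨hfin, -, hss, hL, hR⟩ hrk
    obtain ⟨f₁, hf₁⟩ := S₁.forth hL ((hLle r hfin).trans_lt hrk)
    obtain ⟨f₂, hf₂⟩ := S₂.forth hR ((hRle r hfin).trans_lt hrk)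
    refine ⟨f₁.sumCongr f₂, ?_⟩
    rintro (a | a)
    · have hLins :
          L (insert (Sum.inl a, (f₁.sumCongr f₂) (Sum.inl a)) r) = insert (a, f₁ a) (L r) := by
        ext ⟨x₁, x₂⟩
        simp [L, Prod.ext_iff]
      have hRins : R (insert (Sum.inl a, (f₁.sumCongr f₂) (Sum.inl a)) r) = R r := by
        ext ⟨x₁, x₂⟩
        simp [R, Prod.ext_iff]
      refine ⟨hfin.insert _, (Set.ncard_insert_le _ _).trans (Nat.succ_le_of_lt hrk), ?_, ?_, ?_⟩
      · rintro x (rfl | hx)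
        · simp
        · exact hss x hx
      · show L _ ∈ S₁.carrier
        rw [hLins]; exact hf₁ a
      · show R _ ∈ S₂.carrier
        rw [hRins]; exact hR
    · have hLins : L (insert (Sum.inr a, (f₁.sumCongr f₂) (Sum.inr a)) r) = L r := by
        ext ⟨x₁, x₂⟩
        simp [L, Prod.ext_iff]
      have hRins :
          R (insert (Sum.inr a, (f₁.sumCongr f₂) (Sum.inr a)) r) = insert (a, f₂ a) (R r) := by
        ext ⟨x₁, x₂⟩
        simp [R, Prod.ext_iff]
      refine ⟨hfin.insert _, (Set.ncard_insert_le _ _).trans (Nat.succ_le_of_lt hrk), ?_, ?_, ?_⟩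
      · rintro x (rfl | hx)
        · simp
        · exact hss x hx
      · show L _ ∈ S₁.carrier
        rw [hLins]; exact hL
      · show R _ ∈ S₂.carrier
        rw [hRins]; exact hf₂ a

end CkEquiv

/-! ### The bridge to homomorphism counts (named fact) -/

/-- **`C^k`-equivalence = homomorphism indistinguishability over treewidth `< k`** (NAMED FACT,
not proved here). For `k ≥ 2` and finite simple graphs `G` on `Fin n`, `H` on `Fin m`:
Duplicator wins the bijective `k`-pebble game on `G`, `H` iff `hom(F, G) = hom(F, H)` for every
finite simple graph `F` of treewidth at most `k - 1`, where `hom(F, G) = |F →g G|`. Printed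
sources: Dvořák 2010, Thm 6 (author's version): "there is a closed formula `φ ∈ C^{k+1}` with
`H₁ ⊨ φ`, `H₂ ⊭ φ` iff there is a graph `G` of tree-width at most `k` with
`Hom(G, H₁) ≠ Hom(G, H₂)`" (his `k + 1` is our `k`); equivalently Dell–Grohe–Rattan 2018, Thm 3
(`k ≥ 1`: `hom_{T_k}(G) = hom_{T_k}(H)` iff `k`-WL does not distinguish `G` and `H`) with their
Lemma 12 [Immerman–Lander 1990; Cai–Fürer–Immerman 1992, Thm 5.2] (`k`-WL ≡ `C^{k+1}`); and
Hella 1996 (`≡_{C^k}` on finite structures iff Duplicator wins the bijective `k`-pebble game,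
our definition of `CkEquiv`). Graphs `F` on `Fin j`, `j` ranging over `ℕ`, represent every
finite isomorphism type, and `hom` is isomorphism-invariant, so quantifying over them is
quantifying over all finite graphs of treewidth `< k`. This is literally the hypothesis shape
`∀ m F, treewidth F < k → Nat.card (F →g G) = Nat.card (F →g H)` of the cruxes of route
PneNP/PhaseTwins. The cases `k ≤ 1` are not covered by the sources as printed and are excluded
(`CkEquiv.zero`, `ckEquiv_one_iff_eq` settle them directly).
[cite: Dvorak2010, Thm 6 (C^{k+1}-equivalence iff equal hom counts from tree-width ≤ k)] -/
def Dvorak2010_ckEquiv_iff_homCount : Prop :=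
  ∀ (k : ℕ), 2 ≤ k → ∀ (n m : ℕ) (G : SimpleGraph (Fin n)) (H : SimpleGraph (Fin m)),
    CkEquiv k G H ↔
      ∀ (j : ℕ) (F : SimpleGraph (Fin j)), Literature.Combinatorics.SimpleGraph.treewidth F < k →
        Nat.card (F →g G) = Nat.card (F →g H)

/-! ### The case `k = 1` of the bridge, proved; the bridge for all `k ≥ 1` -/

section kOne

open Literature.Combinatorics.SimpleGraph

/-- A finite graph of treewidth `0` has no edges: the two ends of an edge lie in a common bag of
an optimal tree decomposition, which then has at least two vertices, i.e. width `≥ 1`.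
(Dvořák 2010, §2: "graphs with tree-width at most 1 are forests"; the width-`0` case.)
[folklore] -/
theorem not_adj_of_treewidth_eq_zero {V : Type*} [Fintype V] {F : SimpleGraph V}
    (hF : treewidth F = 0) (u v : V) : ¬ F.Adj u v := by
  classical
  intro huv
  obtain ⟨j, D, hD⟩ := exists_width_eq_treewidth F
  obtain ⟨t, hu, hv⟩ := D.exists_mem_bag_of_adj huv
  have h2 : 2 ≤ (D.bag t).card := by
    rw [← Finset.card_pair huv.ne]
    exact Finset.card_le_card
      (Finset.insert_subset hu (Finset.singleton_subset_iff.2 hv))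
  have h1 := D.card_bag_le_width_add_one t
  omega

/-- Out of an edgeless graph every map is a homomorphism, so `hom(F, G) = |V(G)| ^ |V(F)|`.
[folklore] -/
theorem card_hom_of_not_adj {V W : Type*} [Fintype V] [Fintype W] {F : SimpleGraph V}
    (hF : ∀ u v, ¬ F.Adj u v) (G : SimpleGraph W) :
    Nat.card (F →g G) = Fintype.card W ^ Fintype.card V := by
  let e : (F →g G) ≃ (V → W) :=
    { toFun := fun f => f
      invFun := fun g => ⟨g, fun {a b} h => (hF a b h).elim⟩
      left_inv := fun f => RelHom.ext fun _ => rfl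
      right_inv := fun g => rfl }
  rw [Nat.card_congr e, Nat.card_fun, Nat.card_eq_fintype_card, Nat.card_eq_fintype_card]

/-- The single-vertex graph `K₁` (on `Fin 1`) has treewidth `0 < 1`. [folklore] -/
theorem treewidth_bot_fin_one_lt_one :
    treewidth (⊥ : SimpleGraph (Fin 1)) < 1 :=
  Nat.lt_one_iff.2 (Nat.le_zero.1 (by simpa using treewidth_le_card_sub_one (⊥ : SimpleGraph (Fin 1))))

/-- **The case `k = 1` of the bridge, proved**: for finite graphs `G` on `Fin n`, `H` on `Fin m`,
`G ≡_{C^1} H` iff `hom(F, G) = hom(F, H)` for every finite graph `F` of treewidth `0`. Both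
sides say `n = m`: `≡_{C^1}` is equinumerosity (`ckEquiv_one_iff_eq`); treewidth-`0` graphs are
edgeless, so `hom(F, G) = n ^ |V(F)|`, and `F = K₁` tests `n = m` (Dvořák 2010, proof of Thm 6:
"If `|V(H₁)| ≠ |V(H₂)|`, then `G = K₁`"). [cite: Dvorak2010, Thm 6 (proof, case |V(H₁)| ≠ |V(H₂)|)]
-/
theorem ckEquiv_one_iff_homCount {n m : ℕ} {G : SimpleGraph (Fin n)} {H : SimpleGraph (Fin m)} :
    CkEquiv 1 G H ↔
      ∀ (j : ℕ) (F : SimpleGraph (Fin j)), treewidth F < 1 →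
        Nat.card (F →g G) = Nat.card (F →g H) := by
  rw [ckEquiv_one_iff_eq]
  constructor
  · rintro rfl j F hF
    have hF' := not_adj_of_treewidth_eq_zero (Nat.lt_one_iff.1 hF)
    rw [card_hom_of_not_adj hF', card_hom_of_not_adj hF']
  · intro h
    have h1 := h 1 ⊥ treewidth_bot_fin_one_lt_one
    rwa [card_hom_of_not_adj (fun u v huv => (SimpleGraph.bot_adj u v).1 huv),
      card_hom_of_not_adj (fun u v huv => (SimpleGraph.bot_adj u v).1 huv),
      Fintype.card_fin, Fintype.card_fin, Fintype.card_fin, pow_one, pow_one] at h1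

/-- **The bridge for every `k ≥ 1`, in the orientation of the request** ("for finite graphs
`G`, `H` and `k ≥ 1`: `hom(F, G) = hom(F, H)` for every finite `F` of treewidth `≤ k - 1` iff
`G ≡_{C^k} H`"): the named fact `Dvorak2010_ckEquiv_iff_homCount` (`k ≥ 2`; Dvořák 2010, Thm 6 =
Dell–Grohe–Rattan 2018, Thm 1/3 with Lemma 12, via Hella's theorem) combined with the proved
case `k = 1` (`ckEquiv_one_iff_homCount`). [cite: Dvorak2010, Thm 6] -/
theorem Dvorak2010_ckEquiv_iff_homCount.homCount_iff_ckEquiv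
    (h : Dvorak2010_ckEquiv_iff_homCount) (k : ℕ) (hk : 1 ≤ k) (n m : ℕ)
    (G : SimpleGraph (Fin n)) (H : SimpleGraph (Fin m)) :
    (∀ (j : ℕ) (F : SimpleGraph (Fin j)), treewidth F < k →
        Nat.card (F →g G) = Nat.card (F →g H)) ↔ CkEquiv k G H := by
  rcases Nat.lt_or_eq_of_le hk with hk | rfl
  · exact (h k hk n m G H).symm
  · exact ckEquiv_one_iff_homCount.symm

/-- **From the game to homomorphism counts, for every `k`** (the direction the requesting route
uses: pebble-game constructions ⇒ the typed hom-count hypotheses): if `G ≡_{C^k} H` then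
`hom(F, G) = hom(F, H)` for every finite `F` of treewidth `< k`; `k = 0` is vacuous, `k = 1` is
`ckEquiv_one_iff_homCount`, `k ≥ 2` is the named fact. [cite: Dvorak2010, Thm 6] -/
theorem Dvorak2010_ckEquiv_iff_homCount.homCount_eq
    (h : Dvorak2010_ckEquiv_iff_homCount) {k n m : ℕ}
    {G : SimpleGraph (Fin n)} {H : SimpleGraph (Fin m)} (hGH : CkEquiv k G H)
    (j : ℕ) (F : SimpleGraph (Fin j)) (hF : treewidth F < k) :
    Nat.card (F →g G) = Nat.card (F →g H) := by
  rcases Nat.eq_zero_or_pos k with rfl | hk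
  · exact (Nat.not_lt_zero _ hF).elim
  · exact (h.homCount_iff_ckEquiv k hk n m G H).2 hGH j F hF

/-- Consequently, given the named fact, `≡_{C^k}` of finite graphs on `Fin n`, `Fin m` is
transitive for every `k` (through the hom-count side; `k = 0` by `CkEquiv.zero`).
[cite: Dvorak2010, Thm 6] -/
theorem Dvorak2010_ckEquiv_iff_homCount.ckEquiv_trans
    (h : Dvorak2010_ckEquiv_iff_homCount) {k n m l : ℕ}
    {G : SimpleGraph (Fin n)} {H : SimpleGraph (Fin m)} {K : SimpleGraph (Fin l)}
    (hGH : CkEquiv k G H) (hHK : CkEquiv k H K) : CkEquiv k G K := by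
  rcases Nat.eq_zero_or_pos k with rfl | hk
  · exact CkEquiv.zero G K
  · exact (h.homCount_iff_ckEquiv k hk n l G K).1 fun j F hF =>
      (h.homCount_eq hGH j F hF).trans (h.homCount_eq hHK j F hF)

end kOne

end Literature.ModelTheory.FiniteModelTheory
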